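import Literature.AlgebraicGeometry.Resolution.AbhyankarToroidalCharts
import Literature.AlgebraicGeometry.Resolution.NormalizationOfVarietiesProofs
import Literature.AlgebraicGeometry.Resolution.SmoothImpliesRegular
import Mathlib.RingTheory.Unramified.LocalRing
import Mathlib.RingTheory.Smooth.Field
import HarnessLib

/-!
# Simple smooth points on toroidal models of Abhyankar valued fields (Temkin 2013, §5: bricks for Thm. 5.5.2)

Topic: `Literature/AlgebraicGeometry/Resolution`. PROVED bricks for the assembly of the named fact
`Temkin2013Abhyankar` (`InseparableLocalUniformizationAbhyankar.lean`; M. Temkin, *Inseparable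
local uniformization*, J. Algebra 373 (2013) 65–119 = arXiv:0804.1554v3 — numbers and pages of
this version —, Thm. 5.5.2 (i) for `n = 1`) from the three §5 facts `Temkin2013_Thm553`,
`Temkin2013_Prop543`, `Temkin2013_Thm551iii` of `AbhyankarToroidalCharts.lean`, following the
printed proof of Thm. 5.5.2 (pp. 60–61). In the vocabulary of that file (`toricChart`,
`nrAlg`, `centreLocalRing`, `centreIdeal`, `IsAbhyankarBasis`, `valuationMonoid`):

* **Local ring of the centre.** `nonempty_algEquiv_localization_centreLocalRing`: for an affine
  model `N ⊆ L°` over `l`, the localization of `N` at the centre `𝔪_{L°} ∩ N` is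
  `l`-isomorphic to the explicit local ring `centreLocalRing L° N = {a/b : |b| = 1} ⊆ L`;
  hence smoothness at the centre (`Algebra.IsSmoothAt`), regularity of the local ring and
  formal smoothness of its residue field over `l` depend only on `centreLocalRing L° N`
  (`isSmoothAt_centreIdeal_of_eq`, `isRegularLocalRing_centreIdeal_of_eq`,
  `formallySmooth_residueField_centreIdeal_of_eq`) — the form in which Prop. 5.4.3 ("the local
  rings `A_M` and `A'_M` in `K` coincide") is consumed on p. 61.
* **Étale over a smooth chart ⇒ simple smooth point.**
  `isSmoothAt_and_formallySmooth_residueField_of_isEtaleAt`: if `C ⊆ L°` is formally smooth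
  over `l`, the residue field of the centre of `L°` on `C` is formally smooth (separable) over
  `l`, `Nr_L(C)` is finite over `C` and the projection `Nr_L(C) → Spec C` is étale at the centre
  `𝔮` (`Algebra.IsEtaleAt`, the conclusion of Thm. 5.5.1 (iii)), then `Nr_L(C)` is `l`-smooth at
  `𝔮` with `k(𝔮)` separable over `l` (p. 61: "`x₁` is a regular point and, since `k(x₁) ⊂ K̃₁` is
  separable over `k`, `x₁` is even a simple `k`-smooth point"; here via Mathlib's unramified
  local structure: `k(𝔮)` is finite separable over the residue field of the centre on `C`).
* **The residue field of the centre on a toric chart** `k[M_B]`, `M ⊆ Λ°`, is generated over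
  `l` by the residues of `B_F`, hence purely transcendental and formally smooth
  (`formallySmooth_residueField_centreIdeal_toricChart`; Lemma 5.3.1, p. 55: the local ring
  of the chart at the centre is `k(B_F)[M^B]` localized at `(M^B)`).
* **Free charts.** For the free monoid `M` on a `ℤ`-basis `b` of `Λ` inside `Λ°` (Thm. A.2.1)
  and an Abhyankar basis `B` with `|B_E|` a basis of `Λ` (the hypothesis of Thm. 5.5.1 (iii)),
  `k[M_B] = k[z, y][1/∏ yᵢ]` with `zᵢ = x^{eᵢ}` the monomials of values `bᵢ` and `(z, y)` a
  transcendence basis of `L/l` (`exists_free_chartVar`; §5.1, p. 51: "`K°` is the filtered union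
  of regular local rings `O_{B,M} = ∪_M k(B_F)[M]_m`, where `M` runs through free monoids");
  hence the chart is formally smooth and finitely generated over `l`, and `Nr_L` of it is finite
  over it (`formallySmooth_toricChart_free`, `fg_toricChart_free`, `module_finite_nrAlg_toricChart_free`,
  E. Noether's finiteness `NoetherFiniteIntegralClosure_holds`).

## Sources

* M. Temkin, *Inseparable local uniformization*, arXiv:0804.1554v3: §5.1 (p. 51), Lemma 5.3.1
  (p. 55), §5.4 (p. 56), Thm. 5.5.1 (p. 59), proof of Thm. 5.5.2 (pp. 60–61), Thm. A.2.1 (p. 63).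
-/

noncomputable section

namespace Literature.AlgebraicGeometry.Resolution

open IsLocalRing ValuationSubring MvPolynomial

universe u

/-! ### The local ring of the centre -/

section CentreLocalRing

variable {l L : Type u} [Field l] [Field L] [Algebra l L] (O : ValuationSubring L)
  (N : Subalgebra l L) (hN : N.toSubring ≤ O.toSubring)

/-- Membership in the centre: the value is `< 1`. [folklore] -/
theorem mem_centreIdeal_iff_valuation_lt_one {n : N} :
    n ∈ centreIdeal N O hN ↔ O.valuation (n : L) < 1 := by
  change (⟨(n : L), hN n.2⟩ : O) ∈ IsLocalRing.maximalIdeal O ↔ _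
  rw [ValuationSubring.valuation_lt_one_iff]

/-- **The local ring of the centre, abstractly and concretely**: the localization of an affine
model `N ⊆ L°` at the centre `𝔪_{L°} ∩ N` is `l`-isomorphic to the subalgebra
`centreLocalRing L° N = {a/b : a, b ∈ N, |b| = 1}` of `L` (Temkin 2013, §5.4, p. 56: "let
`A_{B,M}` be the local ring of `x_{B,M}`"). [folklore] -/
theorem nonempty_algEquiv_localization_centreLocalRing :
    Nonempty (Localization.AtPrime (centreIdeal N O hN) ≃ₐ[l] centreLocalRing O N) := by
  letI : Algebra N (centreLocalRing O N) :=
    (Subalgebra.inclusion (le_centreLocalRing (O := O) N)).toRingHom.toAlgebra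
  haveI : IsScalarTower l N (centreLocalRing O N) := IsScalarTower.of_algebraMap_eq fun _ => rfl
  haveI : IsLocalization.AtPrime (centreLocalRing O N) (centreIdeal N O hN) := by
    rw [IsLocalization.AtPrime, isLocalization_iff]
    refine ⟨?_, ?_, ?_⟩
    · rintro ⟨b, hb⟩
      have hb1 : O.valuation (b : L) = 1 := valuation_eq_one_of_notMem_centreIdeal O N hN hb
      have hb0 : (b : L) ≠ 0 := fun h => by simp [h] at hb1
      refine isUnit_iff_exists_inv.mpr ⟨⟨(b : L)⁻¹, ?_⟩, ?_⟩
      · have := inv_mem_centreLocalRing (O := O) b.2 N.one_mem hb1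
        simpa using this
      · exact Subtype.ext (mul_inv_cancel₀ hb0)
    · rintro ⟨z, a, ha, b, hb, hb1, rfl⟩
      have hbN : (⟨b, hb⟩ : N) ∉ centreIdeal N O hN := by
        rw [mem_centreIdeal_iff_valuation_lt_one]
        simp [hb1]
      refine ⟨⟨⟨a, ha⟩, ⟨⟨b, hb⟩, hbN⟩⟩, Subtype.ext ?_⟩
      have hb0 : b ≠ 0 := fun h => by simp [h] at hb1
      change a / b * b = a
      rw [div_mul_cancel₀ a hb0]
    · intro a a' h
      refine ⟨1, ?_⟩
      have : (a : L) = a' := congrArg (fun t : centreLocalRing O N => (t : L)) h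
      rw [Subtype.ext this]
  exact ⟨(IsLocalization.algEquiv (centreIdeal N O hN).primeCompl
    (Localization.AtPrime (centreIdeal N O hN)) (centreLocalRing O N)).restrictScalars l⟩

/-- Two affine models with the same local ring at the centre of `L°` (as subrings of `L`) have
`l`-isomorphic localizations at their centres. [folklore] -/
theorem nonempty_algEquiv_localization_of_centreLocalRing_eq (N' : Subalgebra l L)
    (hN' : N'.toSubring ≤ O.toSubring) (H : centreLocalRing O N = centreLocalRing O N') :
    Nonempty (Localization.AtPrime (centreIdeal N O hN) ≃ₐ[l]
      Localization.AtPrime (centreIdeal N' O hN')) := by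
  obtain ⟨e⟩ := nonempty_algEquiv_localization_centreLocalRing O N hN
  obtain ⟨e'⟩ := nonempty_algEquiv_localization_centreLocalRing O N' hN'
  exact ⟨e.trans ((Subalgebra.equivOfEq _ _ H).trans e'.symm)⟩

variable {O N hN} {N' : Subalgebra l L} {hN' : N'.toSubring ≤ O.toSubring}

/-- Smoothness at the centre depends only on the local ring of the centre. [folklore] -/
theorem isSmoothAt_centreIdeal_of_eq (H : centreLocalRing O N = centreLocalRing O N')
    (h : Algebra.IsSmoothAt l (centreIdeal N' O hN')) : Algebra.IsSmoothAt l (centreIdeal N O hN) := by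
  obtain ⟨e⟩ := nonempty_algEquiv_localization_of_centreLocalRing_eq O N hN N' hN' H
  exact Algebra.FormallySmooth.of_equiv e.symm

/-- Regularity at the centre depends only on the local ring of the centre. [folklore] -/
theorem isRegularLocalRing_centreIdeal_of_eq (H : centreLocalRing O N = centreLocalRing O N')
    (h : IsRegularLocalRing (Localization.AtPrime (centreIdeal N' O hN'))) :
    IsRegularLocalRing (Localization.AtPrime (centreIdeal N O hN)) := by
  obtain ⟨e⟩ := nonempty_algEquiv_localization_of_centreLocalRing_eq O N hN N' hN' H
  exact IsRegularLocalRing.of_ringEquiv e.toRingEquiv.symm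

/-- Formal smoothness over `l` of the residue field of the centre depends only on the local
ring of the centre. [folklore] -/
theorem formallySmooth_residueField_centreIdeal_of_eq
    (H : centreLocalRing O N = centreLocalRing O N')
    (h : Algebra.FormallySmooth l (centreIdeal N' O hN').ResidueField) :
    Algebra.FormallySmooth l (centreIdeal N O hN).ResidueField := by
  obtain ⟨e⟩ := nonempty_algEquiv_localization_of_centreLocalRing_eq O N hN N' hN' H
  exact Algebra.FormallySmooth.of_equiv (ResidueField.mapAlgEquiv e).symm

end CentreLocalRing

/-! ### Étale over a smooth chart with separable residue field ⇒ simple smooth point -/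

section EtaleChart

variable {l L : Type u} [Field l] [Field L] [Algebra l L] (O : ValuationSubring L)
  (C : Subalgebra l L) (hC : C.toSubring ≤ O.toSubring)

/-- The centre of `L°` on `Nr_L(C)` lies over the centre of `L°` on `C`. [folklore] -/
theorem under_centreIdeal_nrAlg :
    (centreIdeal (nrAlg C) O (nrAlg_le_valuationSubring hC)).under C = centreIdeal C O hC := by
  ext c
  rw [Ideal.under_def, Ideal.mem_comap, mem_centreIdeal_iff_valuation_lt_one,
    mem_centreIdeal_iff_valuation_lt_one]
  rfl

/-- **A point étale over a smooth chart with separable residue field is a simple smooth point**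
(the last step of the proof of Temkin 2013, Thm. 5.5.2, p. 61: "`x₁` is a regular point and,
since `k(x₁) ⊂ K̃₁` is separable over `k`, `x₁` is even a simple `k`-smooth point"): if `C ⊆ L°`
is formally smooth over `l`, the residue field of the centre of `L°` on `C` is formally smooth
over `l`, `Nr_L(C)` is finite over `C` and `Nr_L(C) → Spec C` is étale at the centre `𝔮` of
`L°` (`Algebra.IsEtaleAt`), then `Nr_L(C)` is `l`-smooth at `𝔮` (`Algebra.IsSmoothAt`) and
`k(𝔮)` is formally smooth over `l` — being finite separable over the residue field of the
centre on `C` by the unramified local structure (Mathlib). PROVED. [cite: Temkin2013, proof of Thm. 5.5.2 (p. 61 of arXiv:0804.1554v3)] -/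
theorem isSmoothAt_and_formallySmooth_residueField_of_isEtaleAt
    [Algebra.FormallySmooth l C] [Module.Finite C (nrAlg C)]
    (hres : Algebra.FormallySmooth l (centreIdeal C O hC).ResidueField)
    (hEt : Algebra.IsEtaleAt C (centreIdeal (nrAlg C) O (nrAlg_le_valuationSubring hC))) :
    Algebra.IsSmoothAt l (centreIdeal (nrAlg C) O (nrAlg_le_valuationSubring hC)) ∧
      Algebra.FormallySmooth l
        (centreIdeal (nrAlg C) O (nrAlg_le_valuationSubring hC)).ResidueField := by
  haveI : IsScalarTower l C (nrAlg C) := IsScalarTower.of_algebraMap_eq fun _ => rfl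
  set q := centreIdeal (nrAlg C) O (nrAlg_le_valuationSubring hC) with hq
  haveI : Algebra.FormallyEtale C (Localization.AtPrime q) := hEt
  haveI : IsScalarTower l C (Localization.AtPrime q) :=
    IsScalarTower.of_algebraMap_eq fun c => by
      rw [IsScalarTower.algebraMap_apply C (nrAlg C) (Localization.AtPrime q),
        IsScalarTower.algebraMap_apply l (nrAlg C) (Localization.AtPrime q),
        IsScalarTower.algebraMap_apply l C (nrAlg C)]
  have hsm : Algebra.IsSmoothAt l q :=
    Algebra.FormallySmooth.comp l C (Localization.AtPrime q)
  refine ⟨hsm, ?_⟩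
  haveI : Algebra.IsUnramifiedAt C q := inferInstance
  haveI : Algebra.EssFiniteType C (nrAlg C) := inferInstance
  letI := Localization.AtPrime.algebraOfLiesOver (q.under C) q
  haveI hsep : Algebra.IsSeparable (q.under C).ResidueField q.ResidueField := inferInstance
  haveI : Algebra.FormallyEtale (q.under C).ResidueField q.ResidueField :=
    Algebra.FormallyEtale.of_isSeparable _ _
  have h1 : Algebra.FormallySmooth l (q.under C).ResidueField := by
    have key : ∀ (I : Ideal C) [I.IsPrime], I = centreIdeal C O hC →
        Algebra.FormallySmooth l I.ResidueField := by
      rintro I _ rfl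
      exact hres
    exact key _ (under_centreIdeal_nrAlg O C hC)
  exact Algebra.FormallySmooth.comp l (q.under C).ResidueField q.ResidueField

end EtaleChart

/-! ### Values of Laurent monomials -/

section LaurentValues

variable {K : Type u} [Field K] (O : ValuationSubring K) {κ : Type*} (x : κ → K)
  (hx0 : ∀ j, x j ≠ 0)

/-- **The value homomorphism `ℤ^κ → Λ`, `d ↦ |x^d|`** (additively written value group): it is
the `ℤ`-linear combination of the values `|xⱼ|`. [folklore] -/
theorem exists_valuationHom_lmonomial :
    ∃ φ : (κ →₀ ℤ) →+ Additive (ValueGroup O)ˣ,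
      (∀ d, ((Additive.toMul (φ d) : (ValueGroup O)ˣ) : ValueGroup O) =
        O.valuation (d.prod fun j (n : ℤ) => x j ^ n)) ∧
      φ = (Finsupp.linearCombination ℤ (fun j => Additive.ofMul
        (Units.mk0 (O.valuation (x j)) (valuation_ne_zero_of_ne_zero O (hx0 j))))).toAddMonoidHom := by
  let v : (κ →₀ ℤ) → (ValueGroup O)ˣ := fun d =>
    Units.mk0 (O.valuation (d.prod fun j (n : ℤ) => x j ^ n))
      (valuation_ne_zero_of_ne_zero O (lmonomial_ne_zero x hx0 d))
  have hv : ∀ d, (v d : ValueGroup O) = O.valuation (d.prod fun j (n : ℤ) => x j ^ n) := fun _ => rfl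
  let φ : (κ →₀ ℤ) →+ Additive (ValueGroup O)ˣ :=
    { toFun := fun d => Additive.ofMul (v d)
      map_zero' := by
        have : v 0 = 1 := Units.ext (by rw [hv]; simp)
        rw [this]; rfl
      map_add' := fun d d' => by
        have : v (d + d') = v d * v d' :=
          Units.ext (by rw [Units.val_mul, hv, hv, hv, lmonomial_add x hx0, map_mul])
        rw [this]; rfl }
  refine ⟨φ, fun d => rfl, ?_⟩
  refine Finsupp.addHom_ext fun j n => ?_
  rw [LinearMap.toAddMonoidHom_coe, Finsupp.linearCombination_single]
  change Additive.ofMul (v (Finsupp.single j n)) = _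
  rw [← ofMul_zpow]
  congr 1
  ext
  rw [hv, lmonomial_single, map_zpow₀, Units.val_zpow_eq_zpow_val, Units.val_mk0]

variable (hx : LinearIndependent ℤ fun j =>
  Additive.ofMul (Units.mk0 (O.valuation (x j)) (valuation_ne_zero_of_ne_zero O (hx0 j))))
include hx

/-- For `ℤ`-independent values `|xⱼ|`, distinct Laurent monomials (exponents in `ℤ^κ`) have
distinct values. [folklore] -/
theorem valuation_lmonomial_injective :
    Function.Injective fun d : κ →₀ ℤ => O.valuation (d.prod fun j (n : ℤ) => x j ^ n) := by
  obtain ⟨φ, hφ, hφ'⟩ := exists_valuationHom_lmonomial O x hx0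
  intro d d' h
  have h' : φ d = φ d' := by
    apply Additive.toMul.injective
    exact Units.ext (by rw [hφ, hφ]; exact h)
  rw [hφ'] at h'
  exact hx.finsuppLinearCombination_injective h'

/-- A Laurent monomial of value `1` is trivial. [folklore] -/
theorem eq_zero_of_valuation_lmonomial_eq_one {d : κ →₀ ℤ}
    (h : O.valuation (d.prod fun j (n : ℤ) => x j ^ n) = 1) : d = 0 :=
  valuation_lmonomial_injective O x hx0 hx (by simpa using h)

end LaurentValues

/-! ### The residue field of the centre of a toric chart -/

section ChartResidueField

variable {l L : Type u} [Field l] [Field L] [Algebra l L] (O : ValuationSubring L)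
  (hl : ∀ c : l, algebraMap l L c ∈ O) {E F : ℕ} (x : Fin E → L) (y : Fin F → O)
  (hB : IsAbhyankarBasis O hl x y) {M : Submonoid (ValueGroup O)ˣ} (hM : M ≤ valuationMonoid O)

include hB in
/-- **The residue field of the centre of `K°` on a toric chart `k[M_B]` (`M ⊆ Λ°`) is the purely
transcendental `l(ȳ)`** (Temkin 2013, Lemma 5.3.1 and its proof, p. 55: the local ring at the
centre is "the localization of the ring `k(B_F)[M^B]` along the ideal generated by `M^B`"):
the residue field at the centre is generated over `l` by the algebraically independent images
of `B_F` (monomials of value `< 1` vanish there, a monomial of value `1` is trivial), hence is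
formally smooth over `l`. PROVED. [cite: Temkin2013, Lemma 5.3.1 (p. 55 of arXiv:0804.1554v3)] -/
theorem formallySmooth_residueField_centreIdeal_toricChart :
    Algebra.FormallySmooth l (centreIdeal (toricChart (k := l) O x y M) O
      (toricChart_le_valuationSubring x y hl hB.valuation_eq_one hM)).ResidueField := by
  classical
  letI := algebraOfMem l O hl
  haveI := isScalarTower_algebraOfMem l O hl
  set C := toricChart (k := l) O x y M with hCdef
  have hC : C.toSubring ≤ O.toSubring := toricChart_le_valuationSubring x y hl hB.valuation_eq_one hM
  set q := centreIdeal C O hC with hq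
  let κ := q.ResidueField
  let yC : Fin F → C := fun i => ⟨y i, coe_mem_toricChart x y M i⟩
  let v : Fin F → κ := fun i => algebraMap C κ (yC i)
  have hv : AlgebraicIndependent l v := by
    rw [algebraicIndependent_iff]
    intro P hP
    by_contra hP0
    have h1 : aeval v P = algebraMap C κ (aeval yC P) := by
      change aeval (fun i => (IsScalarTower.toAlgHom l C κ) (yC i)) P = _
      rw [← MvPolynomial.comp_aeval, AlgHom.comp_apply]
      rfl
    rw [h1, Ideal.algebraMap_residueField_eq_zero, hq, mem_centreIdeal_iff_valuation_lt_one] at hP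
    have h2 : ((aeval yC P : C) : L) = aeval (fun i => (y i : L)) P := by
      change C.val (aeval yC P) = _
      rw [← AlgHom.comp_apply, MvPolynomial.comp_aeval]
      rfl
    rw [h2, valuation_aeval_eq_one O y hB.algebraicIndependent_residue hP0] at hP
    exact lt_irrefl _ hP
  set T := IntermediateField.adjoin l (Set.range v) with hT
  have key : ∀ c : C, algebraMap C κ c ∈ T := by
    rintro ⟨w, hw⟩
    refine Algebra.adjoin_induction (p := fun m hm => algebraMap C κ ⟨m, hm⟩ ∈ T) ?_ ?_ ?_ ?_ hw
    · rintro m ((⟨i, rfl⟩ | ⟨i, rfl⟩) | ⟨hvm, d, rfl⟩)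
      · exact IntermediateField.subset_adjoin l _ ⟨i, rfl⟩
      · have hmul : (⟨(y i : L)⁻¹, Algebra.subset_adjoin (Or.inl (Or.inr ⟨i, rfl⟩))⟩ : C) * yC i = 1 :=
          Subtype.ext (inv_mul_cancel₀ (hB.coe_ne_zero i))
        have h1 : algebraMap C κ ⟨(y i : L)⁻¹, Algebra.subset_adjoin (Or.inl (Or.inr ⟨i, rfl⟩))⟩ *
            v i = 1 := by
          rw [← map_mul, hmul, map_one]
        rw [eq_inv_of_mul_eq_one_left h1]
        exact inv_mem (IntermediateField.subset_adjoin l _ ⟨i, rfl⟩)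
      · rcases (hvm.mem_valuationSubring O hM |> (O.valuation_le_one_iff _).mpr).lt_or_eq with hlt | heq
        · have : (⟨d.prod fun j (n : ℤ) => x j ^ n, Algebra.subset_adjoin (Or.inr ⟨hvm, d, rfl⟩)⟩ : C) ∈ q := by
            rw [hq, mem_centreIdeal_iff_valuation_lt_one]
            exact hlt
          rw [(Ideal.algebraMap_residueField_eq_zero).mpr this]
          exact zero_mem T
        · have hd : d = 0 := eq_zero_of_valuation_lmonomial_eq_one O x hB.ne_zero hB.linearIndependent heq
          subst hd
          have : (⟨(0 : Fin E →₀ ℤ).prod fun j (n : ℤ) => x j ^ n,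
              Algebra.subset_adjoin (Or.inr ⟨hvm, 0, rfl⟩)⟩ : C) = 1 := Subtype.ext (by simp)
          rw [this, map_one]
          exact one_mem T
    · intro r
      change algebraMap C κ (algebraMap l C r) ∈ T
      rw [← IsScalarTower.algebraMap_apply]
      exact T.algebraMap_mem r
    · intro a b ha hb iha ihb
      have : (⟨a + b, Subalgebra.add_mem _ ha hb⟩ : C) = ⟨a, ha⟩ + ⟨b, hb⟩ := rfl
      rw [this, map_add]
      exact add_mem iha ihb
    · intro a b ha hb iha ihb
      have : (⟨a * b, Subalgebra.mul_mem _ ha hb⟩ : C) = ⟨a, ha⟩ * ⟨b, hb⟩ := rfl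
      rw [this, map_mul]
      exact mul_mem iha ihb
  have htop : IntermediateField.adjoin l (Set.range v) = ⊤ := by
    rw [_root_.eq_top_iff]
    intro w _
    obtain ⟨a, b, -, rfl⟩ := IsFractionRing.div_surjective (A := C ⧸ q) w
    obtain ⟨a, rfl⟩ := Ideal.Quotient.mk_surjective a
    obtain ⟨b, rfl⟩ := Ideal.Quotient.mk_surjective b
    rw [Ideal.algebraMap_quotient_residueField_mk, Ideal.algebraMap_quotient_residueField_mk]
    exact div_mem (key a) (key b)
  exact Algebra.FormallySmooth.of_algebraicIndependent hv htop

end ChartResidueField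

/-! ### Finiteness of the `L`-normalization -/

section FiniteNr

variable {l L : Type u} [Field l] [Field L] [Algebra l L]

/-- **E. Noether's finiteness for the `L`-normalization of an affine model**: if `C ⊆ L` is a
finitely generated `l`-algebra and `L` is finite over the subfield `l(C)` it generates, then
`Nr_L(C)` is a finite `C`-module (`NoetherFiniteIntegralClosure_holds`). [folklore] -/
theorem module_finite_nrAlg (C : Subalgebra l L) (hCfg : C.FG)
    [hfin : FiniteDimensional (IntermediateField.adjoin l (C : Set L)) L] :
    Module.Finite C (nrAlg C) := by
  set KC := IntermediateField.adjoin l (C : Set L) with hKC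
  let ι : C →+* KC :=
    { toFun := fun c => ⟨c, IntermediateField.subset_adjoin l _ c.2⟩
      map_one' := rfl
      map_mul' := fun _ _ => rfl
      map_zero' := rfl
      map_add' := fun _ _ => rfl }
  letI : Algebra C KC := ι.toAlgebra
  haveI : IsScalarTower C KC L := IsScalarTower.of_algebraMap_eq fun _ => rfl
  haveI : FaithfulSMul C KC := (faithfulSMul_iff_algebraMap_injective C KC).mpr
    fun a b hab => Subtype.ext (congrArg (fun t : KC => (t : L)) hab)
  haveI : IsFractionRing C KC := by
    refine IsFractionRing.of_field C KC fun z => ?_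
    obtain ⟨r, hr, s, hs, hz⟩ :=
      (IntermediateField.mem_adjoin_iff_div (F := l) (S := (C : Set L))).mp z.2
    rw [Algebra.adjoin_eq] at hr hs
    refine ⟨⟨r, hr⟩, ⟨s, hs⟩, Subtype.ext ?_⟩
    rw [hz]
    rfl
  haveI : Algebra.FiniteType l C := C.fg_iff_finiteType.mp hCfg
  have h := NoetherFiniteIntegralClosure_holds l C KC L
  let e : integralClosure C L ≃ₗ[C] nrAlg C :=
    { toFun := fun n => ⟨n.1, n.2⟩
      invFun := fun n => ⟨n.1, n.2⟩
      left_inv := fun _ => rfl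
      right_inv := fun _ => rfl
      map_add' := fun _ _ => rfl
      map_smul' := fun _ _ => rfl }
  exact Module.Finite.equiv e

/-- Finite-dimensionality over a larger intermediate field. [folklore] -/
theorem finiteDimensional_of_intermediateField_le {E₁ E₂ : IntermediateField l L} (h : E₁ ≤ E₂)
    [FiniteDimensional E₁ L] : FiniteDimensional E₂ L := by
  letI : Algebra E₁ E₂ := (IntermediateField.inclusion h).toRingHom.toAlgebra
  haveI : IsScalarTower E₁ E₂ L := IsScalarTower.of_algebraMap_eq fun _ => rfl
  exact Module.Finite.of_restrictScalars_finite E₁ E₂ L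

end FiniteNr

/-! ### Free toric charts -/

section FreeChart

variable {l L : Type u} [Field l] [Field L] [Algebra l L] (O : ValuationSubring L)
  (hl : ∀ c : l, algebraMap l L c ∈ O) {E F : ℕ} (x : Fin E → L) (y : Fin F → O)
  (hB : IsAbhyankarBasis O hl x y)
  (hgen : Subgroup.closure (Set.range fun j =>
    Units.mk0 (O.valuation (x j)) (valuation_ne_zero_of_ne_zero O (hB.ne_zero j))) = ⊤)
  {n : ℕ} (b : Module.Basis (Fin n) ℤ (Additive (ValueGroup O)ˣ))

include hgen in
/-- If `|B_E|` generates `Λ`, the values `|xⱼ|` span `Λ` as a `ℤ`-module (additively written).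
[folklore] -/
theorem top_le_span_valuation :
    ⊤ ≤ Submodule.span ℤ (Set.range fun j => Additive.ofMul
      (Units.mk0 (O.valuation (x j)) (valuation_ne_zero_of_ne_zero O (hB.ne_zero j)))) := by
  intro m _
  have hm : Additive.toMul m ∈ Subgroup.closure (Set.range fun j =>
      Units.mk0 (O.valuation (x j)) (valuation_ne_zero_of_ne_zero O (hB.ne_zero j))) := by
    rw [hgen]; trivial
  refine Subgroup.closure_induction (p := fun g _ => Additive.ofMul g ∈ Submodule.span ℤ _)
    ?_ ?_ ?_ ?_ hm
  · rintro _ ⟨j, rfl⟩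
    exact Submodule.subset_span ⟨j, rfl⟩
  · exact Submodule.zero_mem _
  · intro a c _ _ ha hc
    rw [ofMul_mul]
    exact Submodule.add_mem _ ha hc
  · intro a _ ha
    rw [ofMul_inv]
    exact Submodule.neg_mem _ ha

include hgen in
/-- **Free charts are localized polynomial rings** (Temkin 2013, §5.1, p. 51: "`K°` is the
filtered union of regular local rings `O_{B,M} = ∪_M k(B_F)[M]_m`, where `M` runs through free
monoids in the valuation monoid"): for an Abhyankar basis `B = x ⊔ y` of `(L, L°)` over `l` with
`|B_E|` generating `Λ` and the free monoid `M` on a `ℤ`-basis `b₁, …, bₙ` of `Λ`, there are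
Laurent monomials `zᵢ = x^{eᵢ}` with `|zᵢ| = bᵢ` such that `(z, y)` is algebraically independent
over `l`, indeed a transcendence basis of `L/l` (`n = E`), and the toric chart is
`k[M_B] = l[z, y][1/∏ yᵢ]` (`locAway`, `ValuedFunctionFieldsLemmas.lean`). PROVED (a monomial `x^d`
with `|x^d| ∈ M` has `d = ∑ aᵢ eᵢ`, `aᵢ ∈ ℕ`, by injectivity of `d ↦ |x^d|`).
[cite: Temkin2013, Section 5.1 (p. 51 of arXiv:0804.1554v3)] -/
theorem exists_free_chartVar :
    ∃ z : Fin n → L, (∀ i, O.valuation (z i) = ((Additive.toMul (b i) : (ValueGroup O)ˣ) : ValueGroup O)) ∧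
      (∀ i, z i ≠ 0) ∧
      AlgebraicIndependent l (Sum.elim z fun i => (y i : L)) ∧
      IsTranscendenceBasis l (Sum.elim z fun i => (y i : L)) ∧
      ∃ hf : (∏ i, (y i : L)) ∈ Algebra.adjoin l (Set.range (Sum.elim z fun i => (y i : L))),
        toricChart (k := l) O x y (Submonoid.closure (Set.range fun i => Additive.toMul (b i))) =
          locAway (Algebra.adjoin l (Set.range (Sum.elim z fun i => (y i : L))))
            (∏ i, (y i : L)) hf := by
  classical
  letI := algebraOfMem l O hl
  haveI := isScalarTower_algebraOfMem l O hl
  -- the basis of `Λ` given by the values of `B_E`, and the exponents of the `bᵢ`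
  let c : Module.Basis (Fin E) ℤ (Additive (ValueGroup O)ˣ) :=
    Module.Basis.mk hB.linearIndependent (top_le_span_valuation O hl x y hB hgen)
  have hc : ∀ j, c j = Additive.ofMul
      (Units.mk0 (O.valuation (x j)) (valuation_ne_zero_of_ne_zero O (hB.ne_zero j))) := fun j => by
    simp only [c, Module.Basis.mk_apply]
  let e : Fin n → Fin E →₀ ℤ := fun i => c.repr (b i)
  let z : Fin n → L := fun i => (e i).prod fun j (n : ℤ) => x j ^ n
  obtain ⟨φ, hφ, hφ'⟩ := exists_valuationHom_lmonomial O x hB.ne_zero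
  have hφe : ∀ i, φ (e i) = b i := fun i => by
    rw [hφ', LinearMap.toAddMonoidHom_coe]
    have : (fun j => Additive.ofMul (Units.mk0 (O.valuation (x j))
        (valuation_ne_zero_of_ne_zero O (hB.ne_zero j)))) = c := funext fun j => (hc j).symm
    rw [this]
    exact c.linearCombination_repr (b i)
  have hzval : ∀ i, O.valuation (z i) = ((Additive.toMul (b i) : (ValueGroup O)ˣ) : ValueGroup O) :=
    fun i => by rw [← hφe i, hφ]
  have hz0 : ∀ i, z i ≠ 0 := fun i => lmonomial_ne_zero x hB.ne_zero _
  have hzu : ∀ i, Units.mk0 (O.valuation (z i)) (valuation_ne_zero_of_ne_zero O (hz0 i)) =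
      Additive.toMul (b i) := fun i => Units.ext (hzval i)
  have hzli : LinearIndependent ℤ fun i => Additive.ofMul (Units.mk0 (O.valuation (z i))
      (valuation_ne_zero_of_ne_zero O (hz0 i))) := by
    have : (fun i => Additive.ofMul (Units.mk0 (O.valuation (z i))
        (valuation_ne_zero_of_ne_zero O (hz0 i)))) = b := funext fun i => by rw [hzu]; rfl
    rw [this]
    exact b.linearIndependent
  have hind : AlgebraicIndependent l (Sum.elim z fun i => (y i : L)) :=
    algebraicIndependent_sumElim_of_valuation O y hB.algebraicIndependent_residue z
      (injective_valuation_prod_pow O z hz0 hzli)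
  have htb : IsTranscendenceBasis l (Sum.elim z fun i => (y i : L)) := by
    refine hind.isTranscendenceBasis_of_lift_trdeg_le_of_finite ?_
    have h1 := hB.isTranscendenceBasis.lift_cardinalMk_eq_trdeg
    have hnE : n = E := by simpa using Fintype.card_congr (c.indexEquiv b).symm
    subst hnE
    rw [← h1]
  have hf : (∏ i, (y i : L)) ∈ Algebra.adjoin l (Set.range (Sum.elim z fun i => (y i : L))) :=
    Subalgebra.prod_mem _ fun i _ => Algebra.subset_adjoin ⟨Sum.inr i, rfl⟩
  have hf0 : (∏ i, (y i : L)) ≠ 0 := Finset.prod_ne_zero_iff.mpr fun i _ => hB.coe_ne_zero i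
  refine ⟨z, hzval, hz0, hind, htb, hf, ?_⟩
  -- the chart equality
  set M := Submonoid.closure (Set.range fun i => Additive.toMul (b i)) with hM
  rw [locAway_eq_adjoin hf0 rfl]
  apply le_antisymm
  · refine Algebra.adjoin_le ?_
    rintro m ((⟨i, rfl⟩ | ⟨i, rfl⟩) | ⟨⟨γ, hγM, hγ⟩, d, rfl⟩)
    · exact Algebra.subset_adjoin (Set.mem_insert_of_mem _ ⟨Sum.inr i, rfl⟩)
    · have h1 : (y i : L)⁻¹ = (∏ j ∈ Finset.univ.erase i, (y j : L)) * (∏ j, (y j : L))⁻¹ := by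
        rw [eq_mul_inv_iff_mul_eq₀ hf0, ← Finset.mul_prod_erase Finset.univ (fun j => (y j : L))
          (Finset.mem_univ i), inv_mul_cancel_left₀ (hB.coe_ne_zero i)]
      change (y i : L)⁻¹ ∈ _
      rw [h1]
      exact Subalgebra.mul_mem _ (Subalgebra.prod_mem _ fun j _ =>
        Algebra.subset_adjoin (Set.mem_insert_of_mem _ ⟨Sum.inr j, rfl⟩))
        (Algebra.subset_adjoin (Set.mem_insert _ _))
    · -- a monomial `x^d` with `|x^d| = γ ∈ M` is a monomial in the `zᵢ`
      obtain ⟨a, ha⟩ := Submonoid.mem_closure_range_iff_of_fintype.mp hγM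
      have hd : d = ∑ i, a i • e i := by
        apply valuation_lmonomial_injective O x hB.ne_zero hB.linearIndependent
        change O.valuation (d.prod fun j (n : ℤ) => x j ^ n) =
          O.valuation ((∑ i, a i • e i).prod fun j (n : ℤ) => x j ^ n)
        rw [← hγ, ha, ← hφ, map_sum]
        simp only [map_nsmul, hφe, toMul_sum, toMul_nsmul, Units.coe_prod, Units.val_pow_eq_pow_val]
      rw [hd, lmonomial_sum x hB.ne_zero]
      refine Subalgebra.prod_mem _ fun i _ => ?_
      rw [lmonomial_nsmul x hB.ne_zero]
      have hzi : z i ∈ Set.range (Sum.elim z fun i => (y i : L)) := ⟨Sum.inl i, rfl⟩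
      exact Subalgebra.pow_mem _ (Algebra.subset_adjoin (Set.mem_insert_of_mem _ hzi)) _
  · refine Algebra.adjoin_le ?_
    rintro m (rfl | ⟨(i | i), rfl⟩)
    · rw [← Finset.prod_inv_distrib]
      exact Subalgebra.prod_mem _ fun i _ => inv_coe_mem_toricChart x y M i
    · refine lmonomial_mem_toricChart x y _ ?_
      exact ⟨Additive.toMul (b i), Submonoid.subset_closure ⟨i, rfl⟩, (hzval i).symm⟩
    · exact coe_mem_toricChart x y M i

include hgen in
/-- The free toric chart is formally smooth over `l` (a localized polynomial ring). [folklore] -/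
theorem formallySmooth_toricChart_free :
    Algebra.FormallySmooth l
      (toricChart (k := l) O x y (Submonoid.closure (Set.range fun i => Additive.toMul (b i)))) := by
  obtain ⟨z, -, -, hind, -, hf, heq⟩ := exists_free_chartVar O hl x y hB hgen b
  haveI : Algebra.FormallySmooth l (Algebra.adjoin l (Set.range (Sum.elim z fun i => (y i : L)))) :=
    Algebra.FormallySmooth.of_equiv hind.aevalEquiv
  have hf0 : (∏ i, (y i : L)) ≠ 0 := Finset.prod_ne_zero_iff.mpr fun i _ => hB.coe_ne_zero i
  have h := formallySmooth_locAway (R := l)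
    (B := Algebra.adjoin l (Set.range (Sum.elim z fun i => (y i : L))))
    (f := ∏ i, (y i : L)) (hf := hf) hf0
  rw [← heq] at h
  exact h

include hgen in
/-- The free toric chart is a finitely generated `l`-algebra. [folklore] -/
theorem fg_toricChart_free :
    (toricChart (k := l) O x y (Submonoid.closure (Set.range fun i => Additive.toMul (b i)))).FG := by
  classical
  obtain ⟨z, -, -, -, -, hf, heq⟩ := exists_free_chartVar O hl x y hB hgen b
  have hf0 : (∏ i, (y i : L)) ≠ 0 := Finset.prod_ne_zero_iff.mpr fun i _ => hB.coe_ne_zero i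
  rw [heq]
  refine fg_locAway hf0 ⟨(Set.finite_range (Sum.elim z fun i => (y i : L))).toFinset, ?_⟩
  rw [Set.Finite.coe_toFinset]

include hgen in
/-- **`Nr_L` of the free toric chart is finite over it** (E. Noether): `L` is finite over
`l(z, y) ⊆ l(k[M_B])` since `(z, y)` is a transcendence basis of the finitely generated `L/l`.
[folklore] -/
theorem module_finite_nrAlg_toricChart_free (hfg : (⊤ : IntermediateField l L).FG) :
    Module.Finite (toricChart (k := l) O x y (Submonoid.closure (Set.range fun i => Additive.toMul (b i))))
      (nrAlg (toricChart (k := l) O x y (Submonoid.closure (Set.range fun i => Additive.toMul (b i))))) := by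
  obtain ⟨z, -, -, -, htb, hf, heq⟩ := exists_free_chartVar O hl x y hB hgen b
  haveI h1 := finiteDimensional_adjoin_of_isTranscendenceBasis hfg _ htb
  have hle : IntermediateField.adjoin l (Set.range (Sum.elim z fun i => (y i : L))) ≤
      IntermediateField.adjoin l ((toricChart (k := l) O x y
        (Submonoid.closure (Set.range fun i => Additive.toMul (b i))) : Subalgebra l L) : Set L) := by
    refine IntermediateField.adjoin.mono l _ _ fun m hm => ?_
    rw [heq]
    exact le_locAway (Algebra.subset_adjoin hm)
  haveI := finiteDimensional_of_intermediateField_le hle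
  exact module_finite_nrAlg _ (fg_toricChart_free O hl x y hB hgen b)

end FreeChart

end Literature.AlgebraicGeometry.Resolution
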